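import Literature.NumberTheory.EllipticCurves.Kato2004.IwasawaH1ReductionKernel
import HarnessLib

/-!
# K6 crux `MuTransferX9` (stmt-BirchSwinnertonDyer-19276), conditional surface F2
# (`Kato2004.mem_pSmul_of_red_eq_zero`, aside 19844): the `p`-torsion of `H¹(U, T_pW)` has AT MOST
# `p²` elements, for every `U ≤ Γ_ℚ` — input (a) of the «Lemma 8.5 (2) on the pin» programme
# (STATUS l.373/l.379), in the UNIFORM form the pigeonhole step needs

Cell `bsd-smallim`, seat `bsd-smallim-k6-g3` (gen 2).  THEOREMS ONLY (no definition, no named fact,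
no `sorry`).  HONEST FRAMING: helper toward crux 19276 (its conditional surface F2 via the aside item
19844 `KatoReductionModPKernel`); closes nothing.  PARTITION (D-0054): X9 (A4) × p ∈ {5,7}
(+ X10b∧¬Surj at 3) — helper; closes NONE.  Consumer: lur-a g2's
`UniversalNorms.mem_integralH1_of_layerCores_eq_of_smul_mem` (norm-compatible families with integral
`p`-multiples are integral; STATUS l.379), step (b1): the restrictions `res_{Γ_m ⊓ I_𝔓}(φ'^i · z_m)` of
the conjugates of a `p`-th root `z_m` of an integral class form a deterministic periodic sequence IN A
SET OF SIZE ≤ p² — the `p`-torsion of `H¹(Γ_m ⊓ I_𝔓, T_pW)`, bounded by this file independently of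
`m` — whence their sum over a period `p^k`, `k ≥ 3`, vanishes (pigeonhole forcing a `p`-power period;
k6-g3's companion file `…X9PeriodicOrbitSum`).

## What

For `W/ℚ` elliptic, a prime `p` and ANY subgroup `U ≤ Γ_ℚ`:

* `oneCocycleClass_eq_of_prime_nsmul_eq` — two cocycles `φ₁, φ₂ : U → T_pW` with
  `p·φ_i(g) = g·t_i − t_i` and `t₁ ≡ t₂ (mod p)` are cohomologous: `t₂ − t₁ = p·s`
  (`TateModule.exists_prime_nsmul_eq_of_proj_one_eq_zero`) and `T_pW` has no `p`-torsion
  (`TateModule.eq_of_prime_nsmul_eq`), so `φ₂ − φ₁ = ∂s`.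
* **`natCard_setOf_smul_eq_zero_le_sq`** — `#{c ∈ H¹(U, T_pW) | p·c = 0} ≤ p²`, UNIFORMLY IN `U`:
  `p[φ] = 0` gives `p·φ = ∂t`, and `[φ] ↦ t mod p ∈ E[p]` is injective on the `p`-torsion by the
  previous lemma; `#E[p] = p²` (`WeierstrassCurve.card_torsionPoints_eq_sq_holds`).  (This is
  `H¹(U, T_pW)[p] = δ(H⁰(U, E[p])) ↩ E[p]` from the cohomology sequence of `0 → T_pW →ᵖ T_pW → E[p] → 0`,
  on cocycles.)  Finiteness alone is k6-g4 g2's `Kato2004.finite_setOf_prime_smul_eq_zero`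
  (`IwasawaH1ReductionRoots`, landed first); the UNIFORM BOUND is what lets the consumer take ONE period
  `p^k` (`k = 3`) for every layer `m` — `natCard_setOf_smul_eq_zero_lt_pow_three`.
* `natCard_setOf_nsmul_eq_zero_le_sq` — the same with `p • c` (`ℕ`-action).

References: K. Kato, Astérisque 295 (2004) §8.2, Lemma 8.5 (2) (p. 183), §13.8 (pp. 228–229)
[Kato2004Asterisque]; K. Rubin, *Euler Systems* (2000) App. B Prop. B.2.3, B.3.3 [Rubin2000];
J.-P. Serre, *Galois Cohomology* (1997) I §2.2 [SerreGaloisCohomology1997]; J. H. Silverman, *AEC*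
(2009) III §7, Cor. III.6.4 [SilvermanAEC2009].
-/

-- the summit and its single problem are both named `BirchSwinnertonDyer` (registry layout D-0017)
set_option linter.dupNamespace false
set_option autoImplicit false

noncomputable section

open scoped NumberField
open Field CategoryTheory
open Literature.NumberTheory.GaloisRepresentations
open Literature.NumberTheory.EllipticCurves Literature.NumberTheory.EllipticCurves.Kato2004
open Literature.NumberTheory.EllipticCurves.Kato2004.EulerSystemValues
open WeierstrassCurve (geomPoints geomTorsion)

namespace Summit.BirchSwinnertonDyer.BirchSwinnertonDyer.Rank1Residual.UniversalNorms

variable (W : WeierstrassCurve ℚ) [W.IsElliptic] (p : ℕ) [Fact p.Prime]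
  [ContinuousSMul ℤ_[p] (W.tateModule p)]

/-- **Cocycles with congruent `p`-division witnesses are cohomologous.**  If `φ₁, φ₂ : U → T_pW` are
continuous crossed homomorphisms with `p·φ_i(g) = g·t_i − t_i` (`i = 1, 2`) and the witnesses agree
modulo `p` (`(t₁)_1 = (t₂)_1` in `E[p]`), then `[φ₁] = [φ₂]` in `H¹(U, T_pW)`: `t₂ − t₁ = p·s`, so
`p·(φ₂ − φ₁ − ∂s) = 0` and `T_pW` has no `p`-torsion. [cite: Kato2004Asterisque, §13.8 (pp. 228–229)]
[cite: SilvermanAEC2009, III §7] -/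
theorem oneCocycleClass_eq_of_prime_nsmul_eq (U : Subgroup (absoluteGaloisGroup ℚ))
    (φ₁ φ₂ : contOneCocycles (subgroupRep (tateRep W p).toTopRep U)) (t₁ t₂ : W.tateModule p)
    (h₁ : ∀ g : U, p • φ₁.1 g = (subgroupRep (tateRep W p).toTopRep U).ρ g t₁ - t₁)
    (h₂ : ∀ g : U, p • φ₂.1 g = (subgroupRep (tateRep W p).toTopRep U).ρ g t₂ - t₂)
    (ht : TateModule.proj p 1 t₁ = TateModule.proj p 1 t₂) :
    oneCocycleClass _ φ₁ = oneCocycleClass _ φ₂ := by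
  -- `t₂ - t₁ = p • s`
  have h0 : TateModule.proj p 1 (t₂ - t₁) = 0 := by rw [map_sub, ht, sub_self]
  obtain ⟨s, hs, -⟩ := TateModule.exists_prime_nsmul_eq_of_proj_one_eq_zero (t₂ - t₁) h0
  -- `φ₂ - φ₁ = ∂s` since `p •` of the difference vanishes
  rw [eq_comm, ← sub_eq_zero, ← oneCocycleClass_sub, oneCocycleClass_eq_zero_iff]
  refine ⟨s, fun g => ?_⟩
  rw [Submodule.coe_sub, ContinuousMap.sub_apply]
  refine TateModule.eq_of_prime_nsmul_eq ?_
  rw [nsmul_sub, h₁ g, h₂ g, nsmul_sub, ← map_nsmul, hs, map_sub]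
  abel

/-- **The `p`-torsion of `H¹(U, T_pW)` has at most `#E[p] = p²` elements**, for every subgroup
`U ≤ Γ_ℚ`: a class with `p·[φ] = 0` has `p·φ = ∂t` for some `t ∈ T_pW`, and `[φ] ↦ t mod p ∈ E[p]` is
injective on the `p`-torsion (`oneCocycleClass_eq_of_prime_nsmul_eq`).  (`H¹(U, T_pW)[p]` is the image
of `H⁰(U, E[p])` under the connecting map of `0 → T_pW →ᵖ T_pW → E[p] → 0`.)
[cite: Kato2004Asterisque, Lemma 8.5 (2) (p. 183) and §13.8 (pp. 228–229)]
[cite: Rubin2000, App. B Prop. B.2.3] [cite: SilvermanAEC2009, Cor. III.6.4] -/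
theorem natCard_setOf_smul_eq_zero_le_sq (U : Subgroup (absoluteGaloisGroup ℚ)) :
    Nat.card {c : H1 (tateRep W p) U | (p : ℤ_[p]) • c = 0} ≤ p ^ 2 := by
  classical
  have hp : p.Prime := Fact.out
  set S : Set (H1 (tateRep W p) U) := {c | (p : ℤ_[p]) • c = 0} with hS
  -- for each `p`-torsion class choose a cocycle and a witness `t` with `p • φ = ∂t`
  have key : ∀ c : S,
      ∃ (φ : contOneCocycles (subgroupRep (tateRep W p).toTopRep U)) (t : W.tateModule p),
        oneCocycleClass _ φ = c.1 ∧
          ∀ g : U, p • φ.1 g = (subgroupRep (tateRep W p).toTopRep U).ρ g t - t := by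
    intro c
    have hc : (p : ℤ_[p]) • c.1 = 0 := c.2
    obtain ⟨φ, hφ⟩ := oneCocycleClass_surjective _ c.1
    have h0 : oneCocycleClass _ ((p : ℤ_[p]) • φ) = 0 := by rw [oneCocycleClass_smul, hφ, hc]
    rw [oneCocycleClass_eq_zero_iff] at h0
    obtain ⟨t, ht⟩ := h0
    refine ⟨φ, t, hφ, fun g => ?_⟩
    have h := ht g
    rw [Submodule.coe_smul, ContinuousMap.smul_apply, Nat.cast_smul_eq_nsmul] at h
    exact h
  choose φ t hφ ht using key
  -- the residue map `c ↦ t(c) mod p ∈ E[p]` is injective on the `p`-torsion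
  have hmem : ∀ c : S, TateModule.proj p 1 (t c) ∈ geomTorsion W (p : ℤ) := fun c => by
    have h := TateModule.proj_mem_torsionBy 1 (t c)
    rw [pow_one] at h
    exact h
  let Θ : S → geomTorsion W (p : ℤ) := fun c => ⟨TateModule.proj p 1 (t c), hmem c⟩
  have hΘ : Function.Injective Θ := by
    intro c₁ c₂ h
    have h' : TateModule.proj p 1 (t c₁) = TateModule.proj p 1 (t c₂) := congrArg Subtype.val h
    apply Subtype.ext
    rw [← hφ c₁, ← hφ c₂]
    exact oneCocycleClass_eq_of_prime_nsmul_eq W p U (φ c₁) (φ c₂) (t c₁) (t c₂) (ht c₁) (ht c₂) h'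
  -- `#E[p] = p²`
  haveI : Finite (geomTorsion W (p : ℤ)) :=
    W.finite_torsionPoints_holds (AlgebraicClosure ℚ) (by exact_mod_cast hp.ne_zero)
  have hcard : Nat.card (geomTorsion W (p : ℤ)) = p ^ 2 :=
    W.card_torsionPoints_eq_sq_holds (AlgebraicClosure ℚ) (Nat.cast_ne_zero.mpr hp.ne_zero)
  calc Nat.card S ≤ Nat.card (geomTorsion W (p : ℤ)) := Nat.card_le_card_of_injective Θ hΘ
    _ = p ^ 2 := hcard

/-- **Uniform period bound for the consumer**: `#{c ∈ H¹(U, T_pW) | p·c = 0} < p³` for every `U`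
(so a deterministic sequence in this set that is `p^k`-periodic for some `k ≥ 3` has a `p`-power period
`< p^k`). [cite: Kato2004Asterisque, Lemma 8.5 (2) (p. 183)] -/
theorem natCard_setOf_smul_eq_zero_lt_pow_three (U : Subgroup (absoluteGaloisGroup ℚ)) :
    Nat.card {c : H1 (tateRep W p) U | (p : ℤ_[p]) • c = 0} < p ^ 3 :=
  lt_of_le_of_lt (natCard_setOf_smul_eq_zero_le_sq W p U)
    (Nat.pow_lt_pow_right (Fact.out : p.Prime).one_lt (by norm_num))

/-- The same bound with the `ℕ`-action: `#{c ∈ H¹(U, T_pW) | p • c = 0} ≤ p²`.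
[cite: Kato2004Asterisque, Lemma 8.5 (2) (p. 183) and §13.8 (pp. 228–229)] -/
theorem natCard_setOf_nsmul_eq_zero_le_sq (U : Subgroup (absoluteGaloisGroup ℚ)) :
    Nat.card {c : H1 (tateRep W p) U | p • c = 0} ≤ p ^ 2 := by
  have h : {c : H1 (tateRep W p) U | p • c = 0} = {c : H1 (tateRep W p) U | (p : ℤ_[p]) • c = 0} := by
    ext c
    rw [Set.mem_setOf_eq, Set.mem_setOf_eq, Nat.cast_smul_eq_nsmul]
  rw [h]
  exact natCard_setOf_smul_eq_zero_le_sq W p U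

end Summit.BirchSwinnertonDyer.BirchSwinnertonDyer.Rank1Residual.UniversalNorms

end
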